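import Literature.Analysis.FluidPDE.TimePeriodicNSLatticeSpaces
import Literature.Analysis.FunctionSpaces.LatticeSobolevRellich
import HarnessLib

/-!
# Time-periodic Navier–Stokes on `T³` in space–time Fourier coefficients, III: compactness of
# the linearised convective operator (Iooss 1972; Henry 1981, Ch. 8; Kielhöfer 2012, Prop. I.8.1)

Analysis/FluidPDE proof file (theorems only; no definitions, no named facts), sequel of
`TimePeriodicNSLatticeSpaces` on the discharge path of `Literature.Analysis.FluidPDE.PeriodicNSOrbitPersists`.
The hypothesis `IsCompactOperator K` of the bordered local-solvability step
(`TimePeriodicLattice.bordered_local_solve`) is verified for the linearisation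
`K = B(x₀, ·) + B(·, x₀)` of the projected convective map at a state `x₀` whose physical
coefficients `a = x₀/Λ` (the space–time Fourier coefficients of a smooth time-periodic field)
are summable against the weight `(1 + Λ)⟨k⟩`:

* §A Young's inequality `ℓ¹ ⋆ ℓ² ⊂ ℓ²` on the space–time lattice `ℤ × ℤ³` (the tree's
  `Literature.Analysis.Convolution.lintegral_rpow_lintegral_sub_mul_le_young` for the counting
  measure) and the square root `√Λ` of the parabolic weight (`√Λ(m) ≤ √2 (√Λ(m') + √Λ(m−m'))`);
* §B the **smoothing estimates** `∑_m Λ(m) ‖N(a, y/Λ)(m)‖² ≤ C 𝔄(a)² ‖y‖²` and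
  `∑_m Λ(m) ‖N(y/Λ, a)(m)‖² ≤ C 𝔄(a)² ‖y‖²`, `𝔄(a) = ∑ (1 + Λ)⟨k⟩ ‖a‖`: against a smooth
  factor the convective symbol maps the maximal-regularity class into the class
  `∑ Λ |·|² < ∞`, half a parabolic order better than `L²` (the derivative costs `|k| ≲ Λ^{1/2}`);
* §C the **compact embedding** `{z ∈ W : ∑ Λ(m) ‖z(m)‖² ≤ ρ} ⋐ W` (Rellich on the lattice,
  `Lattice.rellich` on `ℤ⁴` transported along `Fin.consEquiv`, since `⟨(n,k)⟩ ≤ 2Λ(n,k)` off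
  `k = 0`);
* §D `IsCompactOperator K` for `K w = B(x₀, w) + B(w, x₀)` whenever `𝔄(x₀/Λ) < ∞`
  (Kielhöfer 2012, Prop. I.8.1: `J₀ = κ₀ d/dt − A₀` is Fredholm of index zero because the
  perturbation is compact relative to the parabolic part).

## References

* G. Iooss, Arch. Rational Mech. Anal. 47 (1972) 301–329. [Iooss1972]
* D. Henry, *Geometric Theory of Semilinear Parabolic Equations*, LNM 840 (1981), Ch. 8, with
  §7.2 (compactness of the period map). [Henry1981]
* H. Kielhöfer, *Bifurcation Theory*, 2nd ed. (2012), Prop. I.8.1 (PDF pp. 59–60). [Kielhofer2012]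
-/

noncomputable section

open scoped BigOperators Topology ENNReal NNReal ComplexConjugate
open Filter Set Function MeasureTheory

namespace Literature.Analysis.FluidPDE

namespace TimePeriodicLattice

open Literature.Analysis.FunctionSpaces Literature.Analysis.FunctionSpaces.Torus
open Literature.Analysis.FunctionSpaces.EuclideanSpace
open Literature.Analysis.FluidPDE.ScalarFourier

-- BODY START
-- NOTATION START
/-- Local notation: the parabolic weight `Λ(n, k) = |n| + |k|²`. -/
local notation:max "Λ" m:max => (|((Prod.fst m : ℤ) : ℝ)| + freqNormSq (Prod.snd m))

/-- Local notation: the convective symbol on `ℤ × ℤ³` (as in `TimePeriodicNSLattice`). -/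
local notation:max "𝐍[" a ", " b "]" m:max =>
  (WithLp.toLp 2 (fun p : Fin 3 => ∑ j : Fin 3, ∑' m' : ℤ × (Fin 3 → ℤ),
    a m' j * (dsym j (Prod.snd m - Prod.snd m') * b (m - m') p)) : EuclideanSpace ℂ (Fin 3))

/-- Local notation: division by the weight (as in `TimePeriodicNSLattice`). -/
local notation:max "𝐜" x:max => (fun mm : ℤ × (Fin 3 → ℤ) =>
  ((((|((Prod.fst mm : ℤ) : ℝ)| + freqNormSq (Prod.snd mm))⁻¹ : ℝ) : ℂ) • x mm))

/-- Local notation: the family of coefficients `ℤ × ℤ³ → ℂ³` of `x ∈ W ⊂ ℓ²`. -/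
local notation:max "𝐰" x:max =>
  (((x : lp (fun _ : ℤ × (Fin 3 → ℤ) => EuclideanSpace ℂ (Fin 3)) 2)) : ℤ × (Fin 3 → ℤ) → EuclideanSpace ℂ (Fin 3))
-- NOTATION END

/-! ## §A″ Young's inequality on `ℤ × ℤ³` and the square root of the weight -/

section Young

/-- **Young's inequality `ℓ¹ ⋆ ℓ² ⊂ ℓ²` on the space–time lattice**:
`∑_m (∑_{m'} f(m') g(m − m'))² ≤ (∑ f)² ∑ g²` (counting measure on the additive group
`ℤ × ℤ³`). [folklore] -/
theorem young_one_two (f g : ℤ × (Fin 3 → ℤ) → ℝ≥0∞) :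
    ∑' m, (∑' m', f m' * g (m - m')) ^ 2 ≤ (∑' m, f m) ^ 2 * ∑' m, g m ^ 2 := by
  have h := Literature.Analysis.Convolution.lintegral_rpow_lintegral_sub_mul_le_young
    (μ := (MeasureTheory.Measure.count : MeasureTheory.Measure (ℤ × (Fin 3 → ℤ)))) (K := g) (Φ := f)
    (measurable_of_countable g).aemeasurable (measurable_of_countable f).aemeasurable
    (b := 2) (m := 1) (r := 2) (by norm_num) le_rfl two_pos (by norm_num)
  simp only [MeasureTheory.lintegral_count] at h
  have hcomm : ∀ m, ∑' m', g (m - m') * f m' = ∑' m', f m' * g (m - m') := fun m =>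
    tsum_congr fun m' => mul_comm _ _
  simp only [hcomm, ENNReal.rpow_two, ENNReal.rpow_one, show (2 : ℝ) / 2 = 1 by norm_num,
    show (2 : ℝ) / 1 = 2 by norm_num] at h
  rw [mul_comm]
  exact h

/-- The mirrored form `∑_m (∑_{m'} g(m') f(m − m'))² ≤ (∑ f)² ∑ g²` (substitute `m' ↦ m − m'`).
[folklore] -/
theorem young_two_one (g f : ℤ × (Fin 3 → ℤ) → ℝ≥0∞) :
    ∑' m, (∑' m', g m' * f (m - m')) ^ 2 ≤ (∑' m, f m) ^ 2 * ∑' m, g m ^ 2 := by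
  have hcomm : ∀ m : ℤ × (Fin 3 → ℤ), ∑' m', g m' * f (m - m') = ∑' m', f m' * g (m - m') := by
    intro m
    rw [← (Equiv.subLeft m).tsum_eq]
    refine tsum_congr fun m' => ?_
    simp only [Equiv.subLeft_apply, sub_sub_cancel, mul_comm]
  simp only [hcomm]
  exact young_one_two f g

/-- `√Λ(m)² = Λ(m)`. [folklore] -/
theorem sq_sqrt_wt (m : ℤ × (Fin 3 → ℤ)) : Real.sqrt (Λ m) ^ 2 = Λ m := Real.sq_sqrt (wt_nonneg m)

/-- **Subadditivity of `√Λ` up to `√2`**: `√Λ(m) ≤ √2 (√Λ(m') + √Λ(m − m'))`. [folklore] -/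
theorem sqrt_wt_le (m m' : ℤ × (Fin 3 → ℤ)) :
    Real.sqrt (Λ m) ≤ Real.sqrt 2 * (Real.sqrt (Λ m') + Real.sqrt (Λ (m - m'))) := by
  have h := wt_le_two_mul_add m m'
  have ha : 0 ≤ Real.sqrt (Λ m') := Real.sqrt_nonneg _
  have hb : 0 ≤ Real.sqrt (Λ (m - m')) := Real.sqrt_nonneg _
  have h2 : 0 ≤ Real.sqrt 2 := Real.sqrt_nonneg _
  rw [Real.sqrt_le_iff]
  refine ⟨by positivity, ?_⟩
  calc Λ m ≤ 2 * Λ m' + 2 * Λ (m - m') := h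
    _ = 2 * (Real.sqrt (Λ m') ^ 2 + Real.sqrt (Λ (m - m')) ^ 2) := by rw [sq_sqrt_wt, sq_sqrt_wt]; ring
    _ ≤ 2 * (Real.sqrt (Λ m') + Real.sqrt (Λ (m - m'))) ^ 2 := by nlinarith [mul_nonneg ha hb]
    _ = (Real.sqrt 2 * (Real.sqrt (Λ m') + Real.sqrt (Λ (m - m')))) ^ 2 := by
        rw [mul_pow, Real.sq_sqrt (by norm_num : (0:ℝ) ≤ 2)]

/-- `√Λ ≤ 1 + Λ`. [folklore] -/
theorem sqrt_wt_le_one_add (m : ℤ × (Fin 3 → ℤ)) : Real.sqrt (Λ m) ≤ 1 + Λ m := by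
  rw [Real.sqrt_le_iff]
  refine ⟨by linarith [wt_nonneg m], ?_⟩
  nlinarith [wt_nonneg m]

/-- `⟨k⟩ ≤ 2 √Λ(n,k)` off `k = 0` (`1 + |k|² ≤ 4|k|² ≤ 4Λ`). [folklore] -/
theorem sobolevWeight_le_two_sqrt_wt {m : ℤ × (Fin 3 → ℤ)} (hm : m.2 ≠ 0) :
    sobolevWeight 1 m.2 ≤ 2 * Real.sqrt (Λ m) := by
  have h1 : sobolevWeight 1 m.2 ^ 2 ≤ 2 * freqNormSq m.2 := SteadyLattice.sobolevWeight_one_sq_le hm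
  have h2 : freqNormSq m.2 ≤ Λ m := freqNormSq_le_wt m
  have h3 : 0 ≤ sobolevWeight 1 m.2 := (sobolevWeight_pos 1 _).le
  have h4 : sobolevWeight 1 m.2 ^ 2 ≤ (2 * Real.sqrt (Λ m)) ^ 2 := by
    rw [mul_pow, sq_sqrt_wt]; nlinarith
  exact (pow_le_pow_iff_left₀ h3 (by positivity) two_ne_zero).1 h4

end Young

/-! ## §B″ Smoothing estimates of the convective symbol against a smooth factor -/

section Smoothing

/-- The termwise bound behind `N(a, y/Λ)`: for `y` vanishing on the zero spatial modes,
`√Λ(m) ‖a(m')‖ ⟨k−k'⟩ ‖(y/Λ)(m−m')‖ ≤ 2√2 (1 + √Λ(m')) ‖a(m')‖ ‖y(m−m')‖`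
(`⟨k''⟩/Λ'' ≤ 2`, `√Λ''⟨k''⟩/Λ'' ≤ 2`). [folklore] -/
theorem sqrt_wt_mul_term_le_left (a y : ℤ × (Fin 3 → ℤ) → EuclideanSpace ℂ (Fin 3)) (hy : ∀ n : ℤ, y (n, 0) = 0)
    (m m' : ℤ × (Fin 3 → ℤ)) :
    ENNReal.ofReal (Real.sqrt (Λ m)) * (‖a m'‖ₑ * (ENNReal.ofReal (sobolevWeight 1 (m.2 - m'.2)) * ‖(𝐜 y) (m - m')‖ₑ)) ≤
      ENNReal.ofReal (2 * Real.sqrt 2 * (1 + Real.sqrt (Λ m'))) * ‖a m'‖ₑ * ‖y (m - m')‖ₑ := by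
  rw [enorm_cw]
  by_cases hk : (m - m').2 = 0
  · have : y (m - m') = 0 := by
      have := hy (m - m').1
      rwa [show (((m - m').1, 0) : ℤ × (Fin 3 → ℤ)) = m - m' from Prod.ext rfl hk.symm] at this
    simp [this]
  · have hpos : 0 < Λ (m - m') := wt_pos hk
    have hk' : m.2 - m'.2 ≠ 0 := by simpa [Prod.snd_sub] using hk
    -- real inequality: `√Λ ⟨k''⟩ Λ''⁻¹ ≤ 2√2 (1 + √Λ')`
    have hreal : Real.sqrt (Λ m) * (sobolevWeight 1 (m.2 - m'.2) * (Λ (m - m'))⁻¹) ≤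
        2 * Real.sqrt 2 * (1 + Real.sqrt (Λ m')) := by
      have h1 := sqrt_wt_le m m'
      have hw2 : sobolevWeight 1 (m.2 - m'.2) ≤ 2 * Λ (m - m') := by
        have := SteadyLattice.sobolevWeight_one_le hk'
        have h2 : freqNormSq (m.2 - m'.2) ≤ Λ (m - m') := freqNormSq_le_wt (m - m')
        linarith
      have hw3 : sobolevWeight 1 (m.2 - m'.2) ≤ 2 * Real.sqrt (Λ (m - m')) := by
        have := sobolevWeight_le_two_sqrt_wt (m := m - m') hk
        simpa [Prod.snd_sub] using this
      have hs0 : 0 ≤ Real.sqrt (Λ m') := Real.sqrt_nonneg _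
      have hs1 : 0 ≤ Real.sqrt (Λ (m - m')) := Real.sqrt_nonneg _
      have hw0 : 0 ≤ sobolevWeight 1 (m.2 - m'.2) := (sobolevWeight_pos 1 _).le
      -- `√Λ · w/Λ'' ≤ √2(√Λ' + √Λ'') w / Λ'' ≤ √2 (√Λ'·2 + 2)`
      have hA : Real.sqrt (Λ m') * (sobolevWeight 1 (m.2 - m'.2) * (Λ (m - m'))⁻¹) ≤ Real.sqrt (Λ m') * 2 := by
        refine mul_le_mul_of_nonneg_left ?_ hs0
        rw [mul_inv_le_iff₀ hpos]; linarith
      have hB : Real.sqrt (Λ (m - m')) * (sobolevWeight 1 (m.2 - m'.2) * (Λ (m - m'))⁻¹) ≤ 2 := by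
        have hsq : Real.sqrt (Λ (m - m')) * Real.sqrt (Λ (m - m')) = Λ (m - m') :=
          Real.mul_self_sqrt (wt_nonneg _)
        rw [← mul_assoc, mul_inv_le_iff₀ hpos]
        nlinarith
      calc Real.sqrt (Λ m) * (sobolevWeight 1 (m.2 - m'.2) * (Λ (m - m'))⁻¹)
          ≤ (Real.sqrt 2 * (Real.sqrt (Λ m') + Real.sqrt (Λ (m - m')))) *
              (sobolevWeight 1 (m.2 - m'.2) * (Λ (m - m'))⁻¹) :=
            mul_le_mul_of_nonneg_right h1 (by positivity)
        _ = Real.sqrt 2 * (Real.sqrt (Λ m') * (sobolevWeight 1 (m.2 - m'.2) * (Λ (m - m'))⁻¹) +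
              Real.sqrt (Λ (m - m')) * (sobolevWeight 1 (m.2 - m'.2) * (Λ (m - m'))⁻¹)) := by ring
        _ ≤ Real.sqrt 2 * (Real.sqrt (Λ m') * 2 + 2) := by gcongr
        _ = 2 * Real.sqrt 2 * (1 + Real.sqrt (Λ m')) := by ring
    calc ENNReal.ofReal (Real.sqrt (Λ m)) * (‖a m'‖ₑ * (ENNReal.ofReal (sobolevWeight 1 (m.2 - m'.2)) *
          (ENNReal.ofReal ((Λ (m - m'))⁻¹) * ‖y (m - m')‖ₑ)))
        = ENNReal.ofReal (Real.sqrt (Λ m) * (sobolevWeight 1 (m.2 - m'.2) * (Λ (m - m'))⁻¹)) *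
            ‖a m'‖ₑ * ‖y (m - m')‖ₑ := by
          rw [ENNReal.ofReal_mul (Real.sqrt_nonneg _), ENNReal.ofReal_mul (sobolevWeight_pos 1 _).le]
          ring
      _ ≤ ENNReal.ofReal (2 * Real.sqrt 2 * (1 + Real.sqrt (Λ m'))) * ‖a m'‖ₑ * ‖y (m - m')‖ₑ := by
          gcongr

/-- The termwise bound behind `N(y/Λ, a)`: for `y` vanishing on the zero spatial modes,
`√Λ(m) ‖(y/Λ)(m')‖ ⟨k−k'⟩ ‖a(m−m')‖ ≤ √2 ‖y(m')‖ (1 + √Λ(m−m')) ⟨k−k'⟩ ‖a(m−m')‖`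
(`√Λ'/Λ' ≤ 1`, `1/Λ' ≤ 1`). [folklore] -/
theorem sqrt_wt_mul_term_le_right (y a : ℤ × (Fin 3 → ℤ) → EuclideanSpace ℂ (Fin 3)) (hy : ∀ n : ℤ, y (n, 0) = 0)
    (m m' : ℤ × (Fin 3 → ℤ)) :
    ENNReal.ofReal (Real.sqrt (Λ m)) * (‖(𝐜 y) m'‖ₑ * (ENNReal.ofReal (sobolevWeight 1 (m.2 - m'.2)) * ‖a (m - m')‖ₑ)) ≤
      ‖y m'‖ₑ * (ENNReal.ofReal (Real.sqrt 2 * ((1 + Real.sqrt (Λ (m - m'))) * sobolevWeight 1 (m - m').2)) *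
        ‖a (m - m')‖ₑ) := by
  rw [enorm_cw]
  by_cases hk : m'.2 = 0
  · have : y m' = 0 := by
      have := hy m'.1
      rwa [show ((m'.1, 0) : ℤ × (Fin 3 → ℤ)) = m' from Prod.ext rfl hk.symm] at this
    simp [this]
  · have hpos : 0 < Λ m' := wt_pos hk
    have h1le : 1 ≤ Λ m' := one_le_wt hk
    have hreal : Real.sqrt (Λ m) * (Λ m')⁻¹ * sobolevWeight 1 (m.2 - m'.2) ≤
        Real.sqrt 2 * ((1 + Real.sqrt (Λ (m - m'))) * sobolevWeight 1 (m - m').2) := by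
      have h1 := sqrt_wt_le m m'
      have hs0 : 0 ≤ Real.sqrt (Λ m') := Real.sqrt_nonneg _
      have hs1 : 0 ≤ Real.sqrt (Λ (m - m')) := Real.sqrt_nonneg _
      have hw0 : 0 ≤ sobolevWeight 1 (m.2 - m'.2) := (sobolevWeight_pos 1 _).le
      have hsq : Real.sqrt (Λ m') * Real.sqrt (Λ m') = Λ m' := Real.mul_self_sqrt (wt_nonneg _)
      have hsle : Real.sqrt (Λ m') ≤ Λ m' := by nlinarith [Real.one_le_sqrt.2 h1le]
      have hA : (Real.sqrt (Λ m') + Real.sqrt (Λ (m - m'))) * (Λ m')⁻¹ ≤ 1 + Real.sqrt (Λ (m - m')) := by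
        rw [add_mul]
        refine add_le_add ?_ ?_
        · rw [mul_inv_le_iff₀ hpos]; linarith
        · rw [mul_inv_le_iff₀ hpos]; nlinarith
      have hk2 : (m - m').2 = m.2 - m'.2 := Prod.snd_sub _ _
      rw [hk2]
      calc Real.sqrt (Λ m) * (Λ m')⁻¹ * sobolevWeight 1 (m.2 - m'.2)
          ≤ (Real.sqrt 2 * (Real.sqrt (Λ m') + Real.sqrt (Λ (m - m')))) * (Λ m')⁻¹ * sobolevWeight 1 (m.2 - m'.2) := by
            gcongr
        _ = Real.sqrt 2 * (((Real.sqrt (Λ m') + Real.sqrt (Λ (m - m'))) * (Λ m')⁻¹) * sobolevWeight 1 (m.2 - m'.2)) := by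
            ring
        _ ≤ Real.sqrt 2 * ((1 + Real.sqrt (Λ (m - m'))) * sobolevWeight 1 (m.2 - m'.2)) := by gcongr
    calc ENNReal.ofReal (Real.sqrt (Λ m)) * (ENNReal.ofReal ((Λ m')⁻¹) * ‖y m'‖ₑ *
          (ENNReal.ofReal (sobolevWeight 1 (m.2 - m'.2)) * ‖a (m - m')‖ₑ))
        = ‖y m'‖ₑ * (ENNReal.ofReal (Real.sqrt (Λ m) * (Λ m')⁻¹ * sobolevWeight 1 (m.2 - m'.2)) * ‖a (m - m')‖ₑ) := by
          rw [ENNReal.ofReal_mul (mul_nonneg (Real.sqrt_nonneg _) (inv_nonneg.2 (wt_nonneg _))),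
            ENNReal.ofReal_mul (Real.sqrt_nonneg _)]
          ring
      _ ≤ ‖y m'‖ₑ * (ENNReal.ofReal (Real.sqrt 2 * ((1 + Real.sqrt (Λ (m - m'))) * sobolevWeight 1 (m - m').2)) *
          ‖a (m - m')‖ₑ) := by gcongr

/-- **Smoothing estimate, smooth factor first**: for `y` vanishing on the zero spatial modes,
`∑_m Λ(m) ‖N(a, y/Λ)(m)‖² ≤ (18π·4√2)² (∑_{m'} (1 + Λ(m'))⟨k'⟩ ‖a(m')‖)² ∑ ‖y‖²`
(`B(v₀, ·)` maps the maximal-regularity class into `∑ Λ|·|² < ∞`). [folklore] -/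
theorem tsum_wt_mul_enorm_nl_sq_le_left (a y : ℤ × (Fin 3 → ℤ) → EuclideanSpace ℂ (Fin 3))
    (hy : ∀ n : ℤ, y (n, 0) = 0) :
    ∑' m : ℤ × (Fin 3 → ℤ), ENNReal.ofReal (Λ m) * ‖𝐍[a, 𝐜 y] m‖ₑ ^ 2 ≤
      ENNReal.ofReal (18 * Real.pi * (4 * Real.sqrt 2)) ^ 2 *
        ((∑' m : ℤ × (Fin 3 → ℤ), ENNReal.ofReal ((1 + Λ m) * sobolevWeight 1 m.2) * ‖a m‖ₑ) ^ 2 *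
          ∑' m : ℤ × (Fin 3 → ℤ), ‖y m‖ₑ ^ 2) := by
  -- the `ℓ¹` factor
  set F : ℤ × (Fin 3 → ℤ) → ℝ≥0∞ := fun m' => ENNReal.ofReal (2 * Real.sqrt 2 * (1 + Real.sqrt (Λ m'))) * ‖a m'‖ₑ with hF
  have hF_le : ∀ m', F m' ≤ ENNReal.ofReal (4 * Real.sqrt 2) *
      (ENNReal.ofReal ((1 + Λ m') * sobolevWeight 1 m'.2) * ‖a m'‖ₑ) := by
    intro m'
    have h1 := sqrt_wt_le_one_add m'
    have h2 : 1 ≤ sobolevWeight 1 m'.2 := Torus.one_le_sobolevWeight zero_le_one _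
    have h3 : 0 ≤ 1 + Λ m' := by linarith [wt_nonneg m']
    have hreal : 2 * Real.sqrt 2 * (1 + Real.sqrt (Λ m')) ≤ 4 * Real.sqrt 2 * ((1 + Λ m') * sobolevWeight 1 m'.2) := by
      calc 2 * Real.sqrt 2 * (1 + Real.sqrt (Λ m')) ≤ 2 * Real.sqrt 2 * (2 * ((1 + Λ m') * 1)) := by
            gcongr; linarith [wt_nonneg m']
        _ ≤ 2 * Real.sqrt 2 * (2 * ((1 + Λ m') * sobolevWeight 1 m'.2)) := by gcongr
        _ = 4 * Real.sqrt 2 * ((1 + Λ m') * sobolevWeight 1 m'.2) := by ring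
    have e : ENNReal.ofReal (4 * Real.sqrt 2) * (ENNReal.ofReal ((1 + Λ m') * sobolevWeight 1 m'.2) * ‖a m'‖ₑ) =
        ENNReal.ofReal (4 * Real.sqrt 2 * ((1 + Λ m') * sobolevWeight 1 m'.2)) * ‖a m'‖ₑ := by
      rw [← mul_assoc, ← ENNReal.ofReal_mul (by positivity)]
    rw [e, hF]
    exact mul_le_mul' (ENNReal.ofReal_le_ofReal hreal) le_rfl
  -- pointwise: `√Λ ‖N‖ ≤ 18π ∑ F(m') ‖y(m−m')‖`
  have hpt : ∀ m, ENNReal.ofReal (Real.sqrt (Λ m)) * ‖𝐍[a, 𝐜 y] m‖ₑ ≤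
      ENNReal.ofReal (18 * Real.pi) * ∑' m', F m' * ‖y (m - m')‖ₑ := by
    intro m
    calc ENNReal.ofReal (Real.sqrt (Λ m)) * ‖𝐍[a, 𝐜 y] m‖ₑ
        ≤ ENNReal.ofReal (Real.sqrt (Λ m)) * (ENNReal.ofReal (18 * Real.pi) *
            ∑' m', ‖a m'‖ₑ * (ENNReal.ofReal (sobolevWeight 1 (m.2 - m'.2)) * ‖(𝐜 y) (m - m')‖ₑ)) :=
          mul_le_mul' le_rfl (enorm_nl_le a (𝐜 y) m)
      _ = ENNReal.ofReal (18 * Real.pi) * ∑' m', ENNReal.ofReal (Real.sqrt (Λ m)) *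
            (‖a m'‖ₑ * (ENNReal.ofReal (sobolevWeight 1 (m.2 - m'.2)) * ‖(𝐜 y) (m - m')‖ₑ)) := by
          rw [mul_left_comm, ← ENNReal.tsum_mul_left]
      _ ≤ ENNReal.ofReal (18 * Real.pi) * ∑' m', F m' * ‖y (m - m')‖ₑ :=
          mul_le_mul' le_rfl (ENNReal.tsum_le_tsum fun m' => sqrt_wt_mul_term_le_left a y hy m m')
  calc ∑' m : ℤ × (Fin 3 → ℤ), ENNReal.ofReal (Λ m) * ‖𝐍[a, 𝐜 y] m‖ₑ ^ 2
      = ∑' m, (ENNReal.ofReal (Real.sqrt (Λ m)) * ‖𝐍[a, 𝐜 y] m‖ₑ) ^ 2 := by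
        refine tsum_congr fun m => ?_
        rw [mul_pow, ← ENNReal.ofReal_pow (Real.sqrt_nonneg _), sq_sqrt_wt]
    _ ≤ ∑' m, (ENNReal.ofReal (18 * Real.pi) * ∑' m', F m' * ‖y (m - m')‖ₑ) ^ 2 :=
        ENNReal.tsum_le_tsum fun m => pow_le_pow_left' (hpt m) 2
    _ = ENNReal.ofReal (18 * Real.pi) ^ 2 * ∑' m, (∑' m', F m' * ‖y (m - m')‖ₑ) ^ 2 := by
        rw [← ENNReal.tsum_mul_left]
        exact tsum_congr fun m => by rw [mul_pow]
    _ ≤ ENNReal.ofReal (18 * Real.pi) ^ 2 * ((∑' m', F m') ^ 2 * ∑' m, ‖y m‖ₑ ^ 2) := by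
        gcongr
        exact young_one_two F fun m => ‖y m‖ₑ
    _ ≤ ENNReal.ofReal (18 * Real.pi) ^ 2 * ((ENNReal.ofReal (4 * Real.sqrt 2) *
          ∑' m', ENNReal.ofReal ((1 + Λ m') * sobolevWeight 1 m'.2) * ‖a m'‖ₑ) ^ 2 * ∑' m, ‖y m‖ₑ ^ 2) := by
        gcongr
        rw [← ENNReal.tsum_mul_left]
        exact ENNReal.tsum_le_tsum hF_le
    _ = ENNReal.ofReal (18 * Real.pi * (4 * Real.sqrt 2)) ^ 2 *
        ((∑' m : ℤ × (Fin 3 → ℤ), ENNReal.ofReal ((1 + Λ m) * sobolevWeight 1 m.2) * ‖a m‖ₑ) ^ 2 *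
          ∑' m : ℤ × (Fin 3 → ℤ), ‖y m‖ₑ ^ 2) := by
        have hc : ENNReal.ofReal (18 * Real.pi * (4 * Real.sqrt 2)) =
            ENNReal.ofReal (18 * Real.pi) * ENNReal.ofReal (4 * Real.sqrt 2) := ENNReal.ofReal_mul (by positivity)
        rw [hc]
        ring

/-- **Smoothing estimate, smooth factor second**: for `y` vanishing on the zero spatial modes,
`∑_m Λ(m) ‖N(y/Λ, a)(m)‖² ≤ (18π·2√2)² (∑_{m'} (1 + Λ(m'))⟨k'⟩ ‖a(m')‖)² ∑ ‖y‖²`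
(`B(·, v₀)` maps the maximal-regularity class into `∑ Λ|·|² < ∞`). [folklore] -/
theorem tsum_wt_mul_enorm_nl_sq_le_right (y a : ℤ × (Fin 3 → ℤ) → EuclideanSpace ℂ (Fin 3))
    (hy : ∀ n : ℤ, y (n, 0) = 0) :
    ∑' m : ℤ × (Fin 3 → ℤ), ENNReal.ofReal (Λ m) * ‖𝐍[𝐜 y, a] m‖ₑ ^ 2 ≤
      ENNReal.ofReal (18 * Real.pi * (2 * Real.sqrt 2)) ^ 2 *
        ((∑' m : ℤ × (Fin 3 → ℤ), ENNReal.ofReal ((1 + Λ m) * sobolevWeight 1 m.2) * ‖a m‖ₑ) ^ 2 *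
          ∑' m : ℤ × (Fin 3 → ℤ), ‖y m‖ₑ ^ 2) := by
  set G : ℤ × (Fin 3 → ℤ) → ℝ≥0∞ := fun l =>
    ENNReal.ofReal (Real.sqrt 2 * ((1 + Real.sqrt (Λ l)) * sobolevWeight 1 l.2)) * ‖a l‖ₑ with hG
  have hG_le : ∀ l, G l ≤ ENNReal.ofReal (2 * Real.sqrt 2) *
      (ENNReal.ofReal ((1 + Λ l) * sobolevWeight 1 l.2) * ‖a l‖ₑ) := by
    intro l
    have h1 := sqrt_wt_le_one_add l
    have hw0 : 0 ≤ sobolevWeight 1 l.2 := (sobolevWeight_pos 1 _).le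
    have hreal : Real.sqrt 2 * ((1 + Real.sqrt (Λ l)) * sobolevWeight 1 l.2) ≤
        2 * Real.sqrt 2 * ((1 + Λ l) * sobolevWeight 1 l.2) := by
      have : (1 + Real.sqrt (Λ l)) * sobolevWeight 1 l.2 ≤ (2 * (1 + Λ l)) * sobolevWeight 1 l.2 :=
        mul_le_mul_of_nonneg_right (by linarith [wt_nonneg l]) hw0
      calc Real.sqrt 2 * ((1 + Real.sqrt (Λ l)) * sobolevWeight 1 l.2)
          ≤ Real.sqrt 2 * ((2 * (1 + Λ l)) * sobolevWeight 1 l.2) := mul_le_mul_of_nonneg_left this (Real.sqrt_nonneg _)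
        _ = 2 * Real.sqrt 2 * ((1 + Λ l) * sobolevWeight 1 l.2) := by ring
    have e : ENNReal.ofReal (2 * Real.sqrt 2) * (ENNReal.ofReal ((1 + Λ l) * sobolevWeight 1 l.2) * ‖a l‖ₑ) =
        ENNReal.ofReal (2 * Real.sqrt 2 * ((1 + Λ l) * sobolevWeight 1 l.2)) * ‖a l‖ₑ := by
      rw [← mul_assoc, ← ENNReal.ofReal_mul (by positivity)]
    rw [e, hG]
    exact mul_le_mul' (ENNReal.ofReal_le_ofReal hreal) le_rfl
  have hpt : ∀ m, ENNReal.ofReal (Real.sqrt (Λ m)) * ‖𝐍[𝐜 y, a] m‖ₑ ≤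
      ENNReal.ofReal (18 * Real.pi) * ∑' m', ‖y m'‖ₑ * G (m - m') := by
    intro m
    calc ENNReal.ofReal (Real.sqrt (Λ m)) * ‖𝐍[𝐜 y, a] m‖ₑ
        ≤ ENNReal.ofReal (Real.sqrt (Λ m)) * (ENNReal.ofReal (18 * Real.pi) *
            ∑' m', ‖(𝐜 y) m'‖ₑ * (ENNReal.ofReal (sobolevWeight 1 (m.2 - m'.2)) * ‖a (m - m')‖ₑ)) :=
          mul_le_mul' le_rfl (enorm_nl_le (𝐜 y) a m)
      _ = ENNReal.ofReal (18 * Real.pi) * ∑' m', ENNReal.ofReal (Real.sqrt (Λ m)) *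
            (‖(𝐜 y) m'‖ₑ * (ENNReal.ofReal (sobolevWeight 1 (m.2 - m'.2)) * ‖a (m - m')‖ₑ)) := by
          rw [mul_left_comm, ← ENNReal.tsum_mul_left]
      _ ≤ ENNReal.ofReal (18 * Real.pi) * ∑' m', ‖y m'‖ₑ * G (m - m') :=
          mul_le_mul' le_rfl (ENNReal.tsum_le_tsum fun m' => sqrt_wt_mul_term_le_right y a hy m m')
  calc ∑' m : ℤ × (Fin 3 → ℤ), ENNReal.ofReal (Λ m) * ‖𝐍[𝐜 y, a] m‖ₑ ^ 2
      = ∑' m, (ENNReal.ofReal (Real.sqrt (Λ m)) * ‖𝐍[𝐜 y, a] m‖ₑ) ^ 2 := by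
        refine tsum_congr fun m => ?_
        rw [mul_pow, ← ENNReal.ofReal_pow (Real.sqrt_nonneg _), sq_sqrt_wt]
    _ ≤ ∑' m, (ENNReal.ofReal (18 * Real.pi) * ∑' m', ‖y m'‖ₑ * G (m - m')) ^ 2 :=
        ENNReal.tsum_le_tsum fun m => pow_le_pow_left' (hpt m) 2
    _ = ENNReal.ofReal (18 * Real.pi) ^ 2 * ∑' m, (∑' m', ‖y m'‖ₑ * G (m - m')) ^ 2 := by
        rw [← ENNReal.tsum_mul_left]
        exact tsum_congr fun m => by rw [mul_pow]
    _ ≤ ENNReal.ofReal (18 * Real.pi) ^ 2 * ((∑' l, G l) ^ 2 * ∑' m, ‖y m‖ₑ ^ 2) := by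
        gcongr
        exact young_two_one (fun m => ‖y m‖ₑ) G
    _ ≤ ENNReal.ofReal (18 * Real.pi) ^ 2 * ((ENNReal.ofReal (2 * Real.sqrt 2) *
          ∑' l, ENNReal.ofReal ((1 + Λ l) * sobolevWeight 1 l.2) * ‖a l‖ₑ) ^ 2 * ∑' m, ‖y m‖ₑ ^ 2) := by
        gcongr
        rw [← ENNReal.tsum_mul_left]
        exact ENNReal.tsum_le_tsum hG_le
    _ = ENNReal.ofReal (18 * Real.pi * (2 * Real.sqrt 2)) ^ 2 *
        ((∑' m : ℤ × (Fin 3 → ℤ), ENNReal.ofReal ((1 + Λ m) * sobolevWeight 1 m.2) * ‖a m‖ₑ) ^ 2 *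
          ∑' m : ℤ × (Fin 3 → ℤ), ‖y m‖ₑ ^ 2) := by
        have hc : ENNReal.ofReal (18 * Real.pi * (2 * Real.sqrt 2)) =
            ENNReal.ofReal (18 * Real.pi) * ENNReal.ofReal (2 * Real.sqrt 2) := ENNReal.ofReal_mul (by positivity)
        rw [hc]
        ring

/-- The Leray symbol does not increase the weighted sum. [folklore] -/
theorem tsum_wt_mul_enorm_leray_le (g : ℤ × (Fin 3 → ℤ) → EuclideanSpace ℂ (Fin 3)) :
    ∑' m : ℤ × (Fin 3 → ℤ), ENNReal.ofReal (Λ m) * ‖Torus.lerayCoeff m.2 (g m)‖ₑ ^ 2 ≤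
      ∑' m : ℤ × (Fin 3 → ℤ), ENNReal.ofReal (Λ m) * ‖g m‖ₑ ^ 2 :=
  ENNReal.tsum_le_tsum fun _ => mul_le_mul' le_rfl (pow_le_pow_left' (SteadyLattice.enorm_lerayCoeff_le _ _) 2)

/-- **The linearised convective operator gains half a parabolic order**: for `x₀, w ∈ ℓ²`
vanishing on the zero spatial modes and `𝔄 = ∑ (1 + Λ)⟨k⟩ ‖x₀/Λ‖ < ∞`,
`∑_m Λ(m) ‖Π N(x₀/Λ, w/Λ)(m) + Π N(w/Λ, x₀/Λ)(m)‖² ≤ (2 (18π·4√2)² + 2 (18π·2√2)²) 𝔄² ∑‖w‖²`.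
[folklore] -/
theorem tsum_wt_mul_enorm_linearised_le (x₀ w : ℤ × (Fin 3 → ℤ) → EuclideanSpace ℂ (Fin 3))
    (hw : ∀ n : ℤ, w (n, 0) = 0) :
    ∑' m : ℤ × (Fin 3 → ℤ), ENNReal.ofReal (Λ m) *
        ‖Torus.lerayCoeff m.2 (𝐍[𝐜 x₀, 𝐜 w] m) + Torus.lerayCoeff m.2 (𝐍[𝐜 w, 𝐜 x₀] m)‖ₑ ^ 2 ≤
      (2 * ENNReal.ofReal (18 * Real.pi * (4 * Real.sqrt 2)) ^ 2 + 2 * ENNReal.ofReal (18 * Real.pi * (2 * Real.sqrt 2)) ^ 2) *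
        ((∑' m : ℤ × (Fin 3 → ℤ), ENNReal.ofReal ((1 + Λ m) * sobolevWeight 1 m.2) * ‖(𝐜 x₀) m‖ₑ) ^ 2 *
          ∑' m : ℤ × (Fin 3 → ℤ), ‖w m‖ₑ ^ 2) := by
  set A : ℝ≥0∞ := (∑' m : ℤ × (Fin 3 → ℤ), ENNReal.ofReal ((1 + Λ m) * sobolevWeight 1 m.2) * ‖(𝐜 x₀) m‖ₑ) ^ 2 *
    ∑' m : ℤ × (Fin 3 → ℤ), ‖w m‖ₑ ^ 2 with hA
  have h1 := (tsum_wt_mul_enorm_leray_le fun m => 𝐍[𝐜 x₀, 𝐜 w] m).trans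
    (tsum_wt_mul_enorm_nl_sq_le_left (𝐜 x₀) w hw)
  have h2 := (tsum_wt_mul_enorm_leray_le fun m => 𝐍[𝐜 w, 𝐜 x₀] m).trans
    (tsum_wt_mul_enorm_nl_sq_le_right w (𝐜 x₀) hw)
  -- `‖u + v‖² ≤ 2‖u‖² + 2‖v‖²`
  have hsq : ∀ u v : EuclideanSpace ℂ (Fin 3), ‖u + v‖ₑ ^ 2 ≤ 2 * ‖u‖ₑ ^ 2 + 2 * ‖v‖ₑ ^ 2 := by
    intro u v
    calc ‖u + v‖ₑ ^ 2 ≤ (‖u‖ₑ + ‖v‖ₑ) ^ 2 := pow_le_pow_left' (enorm_add_le u v) 2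
      _ ≤ 2 * ‖u‖ₑ ^ 2 + 2 * ‖v‖ₑ ^ 2 := by
          rw [add_sq]
          have : 2 * ‖u‖ₑ * ‖v‖ₑ ≤ ‖u‖ₑ ^ 2 + ‖v‖ₑ ^ 2 := by
            -- `2ab ≤ a² + b²` in `ℝ≥0∞`
            rcases eq_or_ne ‖u‖ₑ ∞ with hu | hu
            · simp [hu]
            rcases eq_or_ne ‖v‖ₑ ∞ with hv | hv
            · simp [hv]
            have key := ENNReal.ofReal_le_ofReal (two_mul_le_add_sq ‖u‖ₑ.toReal ‖v‖ₑ.toReal)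
            rw [ENNReal.ofReal_mul (by positivity), ENNReal.ofReal_mul (by positivity),
              ENNReal.ofReal_add (by positivity) (by positivity), ENNReal.ofReal_pow ENNReal.toReal_nonneg,
              ENNReal.ofReal_pow ENNReal.toReal_nonneg, ENNReal.ofReal_toReal hu, ENNReal.ofReal_toReal hv,
              ENNReal.ofReal_ofNat] at key
            exact key
          calc ‖u‖ₑ ^ 2 + 2 * ‖u‖ₑ * ‖v‖ₑ + ‖v‖ₑ ^ 2 ≤ ‖u‖ₑ ^ 2 + (‖u‖ₑ ^ 2 + ‖v‖ₑ ^ 2) + ‖v‖ₑ ^ 2 := by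
                gcongr
            _ = 2 * ‖u‖ₑ ^ 2 + 2 * ‖v‖ₑ ^ 2 := by ring
  calc ∑' m : ℤ × (Fin 3 → ℤ), ENNReal.ofReal (Λ m) *
        ‖Torus.lerayCoeff m.2 (𝐍[𝐜 x₀, 𝐜 w] m) + Torus.lerayCoeff m.2 (𝐍[𝐜 w, 𝐜 x₀] m)‖ₑ ^ 2
      ≤ ∑' m : ℤ × (Fin 3 → ℤ), (2 * (ENNReal.ofReal (Λ m) * ‖Torus.lerayCoeff m.2 (𝐍[𝐜 x₀, 𝐜 w] m)‖ₑ ^ 2) +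
          2 * (ENNReal.ofReal (Λ m) * ‖Torus.lerayCoeff m.2 (𝐍[𝐜 w, 𝐜 x₀] m)‖ₑ ^ 2)) := by
        refine ENNReal.tsum_le_tsum fun m => ?_
        calc ENNReal.ofReal (Λ m) * ‖Torus.lerayCoeff m.2 (𝐍[𝐜 x₀, 𝐜 w] m) +
              Torus.lerayCoeff m.2 (𝐍[𝐜 w, 𝐜 x₀] m)‖ₑ ^ 2
            ≤ ENNReal.ofReal (Λ m) * (2 * ‖Torus.lerayCoeff m.2 (𝐍[𝐜 x₀, 𝐜 w] m)‖ₑ ^ 2 +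
                2 * ‖Torus.lerayCoeff m.2 (𝐍[𝐜 w, 𝐜 x₀] m)‖ₑ ^ 2) := mul_le_mul' le_rfl (hsq _ _)
          _ = _ := by ring
    _ = 2 * ∑' m : ℤ × (Fin 3 → ℤ), ENNReal.ofReal (Λ m) * ‖Torus.lerayCoeff m.2 (𝐍[𝐜 x₀, 𝐜 w] m)‖ₑ ^ 2 +
        2 * ∑' m : ℤ × (Fin 3 → ℤ), ENNReal.ofReal (Λ m) * ‖Torus.lerayCoeff m.2 (𝐍[𝐜 w, 𝐜 x₀] m)‖ₑ ^ 2 := by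
        rw [ENNReal.tsum_add, ENNReal.tsum_mul_left, ENNReal.tsum_mul_left]
    _ ≤ 2 * (ENNReal.ofReal (18 * Real.pi * (4 * Real.sqrt 2)) ^ 2 * A) +
        2 * (ENNReal.ofReal (18 * Real.pi * (2 * Real.sqrt 2)) ^ 2 * A) := by
        gcongr
    _ = (2 * ENNReal.ofReal (18 * Real.pi * (4 * Real.sqrt 2)) ^ 2 + 2 * ENNReal.ofReal (18 * Real.pi * (2 * Real.sqrt 2)) ^ 2) *
        A := by ring

end Smoothing

/-! ## §C″ The compact embedding `{∑ Λ |z|² ≤ ρ} ⋐ W` -/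

section Embedding

variable {W : Submodule ℝ (lp (fun _ : ℤ × (Fin 3 → ℤ) => EuclideanSpace ℂ (Fin 3)) 2)}
variable (hW : ∀ x : lp (fun _ : ℤ × (Fin 3 → ℤ) => EuclideanSpace ℂ (Fin 3)) 2, x ∈ W ↔
      (∀ n : ℤ, (x : ℤ × (Fin 3 → ℤ) → EuclideanSpace ℂ (Fin 3)) (n, 0) = 0) ∧
      (∀ mm : ℤ × (Fin 3 → ℤ), (∑ jj : Fin 3, ((mm.2 jj : ℤ) : ℂ) *
        ((x : ℤ × (Fin 3 → ℤ) → EuclideanSpace ℂ (Fin 3)) mm) jj) = 0) ∧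
      (∀ mm : ℤ × (Fin 3 → ℤ), (x : ℤ × (Fin 3 → ℤ) → EuclideanSpace ℂ (Fin 3)) (-mm) =
        conjVec ((x : ℤ × (Fin 3 → ℤ) → EuclideanSpace ℂ (Fin 3)) mm)))

/-- `|k|²` of a `4`-frequency split as first coordinate and tail:
`|cons n k|² = n² + |k|²`. [folklore] -/
theorem freqNormSq_cons (n : ℤ) (k : Fin 3 → ℤ) :
    freqNormSq (Fin.cons n k : Fin 4 → ℤ) = ((n : ℤ) : ℝ) ^ 2 + freqNormSq k := by
  simp only [freqNormSq, Fin.sum_univ_succ, Fin.cons_zero, Fin.cons_succ]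

/-- **The Japanese bracket of `(n, k) ∈ ℤ⁴` is dominated by the parabolic weight** off `k = 0`:
`⟨(n,k)⟩ ≤ 2Λ(n,k)` (`(1 + n² + |k|²)^{1/2} ≤ 1 + |n| + |k|² ≤ 2(|n| + |k|²)`). [folklore] -/
theorem sobolevWeight_half_sq_cons_le {m : ℤ × (Fin 3 → ℤ)} (hm : m.2 ≠ 0) :
    sobolevWeight (1 / 2) (Fin.cons m.1 m.2 : Fin 4 → ℤ) ^ 2 ≤ 2 * Λ m := by
  have hk : 1 ≤ freqNormSq m.2 := Torus.one_le_freqNormSq hm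
  have hn : 0 ≤ |((m.1 : ℤ) : ℝ)| := abs_nonneg _
  have h0 : 0 ≤ 1 + freqNormSq (Fin.cons m.1 m.2 : Fin 4 → ℤ) := by
    linarith [freqNormSq_nonneg (Fin.cons m.1 m.2 : Fin 4 → ℤ)]
  -- `⟨c⟩_{1/2}² = ⟨c⟩_1`
  have h1 : sobolevWeight (1 / 2) (Fin.cons m.1 m.2 : Fin 4 → ℤ) ^ 2 = sobolevWeight 1 (Fin.cons m.1 m.2 : Fin 4 → ℤ) := by
    rw [sobolevWeight, sobolevWeight, ← Real.rpow_natCast, ← Real.rpow_mul h0]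
    norm_num
  rw [h1]
  -- `⟨c⟩_1² = 1 + n² + |k|² ≤ (2Λ)²`
  have h2 : sobolevWeight 1 (Fin.cons m.1 m.2 : Fin 4 → ℤ) ^ 2 ≤ (2 * Λ m) ^ 2 := by
    rw [SteadyNS.sobolevWeight_one_sq, freqNormSq_cons]
    have hsq : ((m.1 : ℤ) : ℝ) ^ 2 = |((m.1 : ℤ) : ℝ)| ^ 2 := (sq_abs _).symm
    rw [hsq]
    nlinarith [freqNormSq_nonneg m.2]
  exact (pow_le_pow_iff_left₀ (sobolevWeight_pos _ _).le (by positivity) two_ne_zero).1 h2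

include hW in
/-- **The compact embedding**: for a closed subspace `W` of `ℓ²(ℤ × ℤ³; ℂ³)` whose elements vanish
on the zero spatial modes and finite `ρ`, the set `{z ∈ W : ∑_m Λ(m) ‖z(m)‖² ≤ ρ}` is compact
(Rellich on `ℤ⁴`, `Lattice.rellich`, after transport along `Fin.consEquiv`; completeness of
`W`). [folklore] -/
theorem isCompact_wt_le (hWc : IsClosed (W : Set (lp (fun _ : ℤ × (Fin 3 → ℤ) => EuclideanSpace ℂ (Fin 3)) 2)))
    {ρ : ℝ≥0∞} (hρ : ρ ≠ ∞) :
    IsCompact {z : W | ∑' m, ENNReal.ofReal (Λ m) * ‖(𝐰 z) m‖ₑ ^ 2 ≤ ρ} := by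
  haveI : CompleteSpace W := hWc.completeSpace_coe
  -- closedness
  have hclosed : IsClosed {z : W | ∑' m, ENNReal.ofReal (Λ m) * ‖(𝐰 z) m‖ₑ ^ 2 ≤ ρ} := by
    have hcont : ∀ m : ℤ × (Fin 3 → ℤ), Continuous fun z : W => ENNReal.ofReal (Λ m) * ‖(𝐰 z) m‖ₑ ^ 2 := by
      intro m
      have e : (fun z : W => ENNReal.ofReal (Λ m) * ‖(𝐰 z) m‖ₑ ^ 2) =
          fun z : W => ENNReal.ofReal (Λ m * ‖(𝐰 z) m‖ ^ 2) := by
        funext z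
        rw [ENNReal.ofReal_mul (wt_nonneg m), ENNReal.ofReal_pow (norm_nonneg _), ofReal_norm]
      rw [e]
      exact ENNReal.continuous_ofReal.comp (continuous_const.mul
        (((l2_continuous_apply m).comp continuous_subtype_val).norm.pow 2))
    have e : {z : W | ∑' m, ENNReal.ofReal (Λ m) * ‖(𝐰 z) m‖ₑ ^ 2 ≤ ρ} =
        ⋂ Fs : Finset (ℤ × (Fin 3 → ℤ)), {z : W | ∑ m ∈ Fs, ENNReal.ofReal (Λ m) * ‖(𝐰 z) m‖ₑ ^ 2 ≤ ρ} := by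
      ext z
      simp only [Set.mem_setOf_eq, Set.mem_iInter, ENNReal.tsum_eq_iSup_sum, iSup_le_iff]
    rw [e]
    exact isClosed_iInter fun Fs => isClosed_le (continuous_finsetSum Fs fun m _ => hcont m) continuous_const
  -- sequential compactness by Rellich on `ℤ⁴`
  rw [isCompact_iff_isSeqCompact]
  intro z hz
  set e4 : ℤ × (Fin 3 → ℤ) ≃ (Fin 4 → ℤ) := Fin.consEquiv (fun _ : Fin 4 => ℤ) with he4
  set u : ℕ → (Fin 4 → ℤ) → EuclideanSpace ℂ (Fin 3) := fun i mm => (𝐰 (z i)) (e4.symm mm) with hu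
  have hbound : ∀ i, Lattice.eNormSq (1 / 2) (u i) ≤ 2 * ρ := by
    intro i
    have h1 : Lattice.eNormSq (1 / 2) (u i) =
        ∑' m : ℤ × (Fin 3 → ℤ), ENNReal.ofReal (sobolevWeight (1 / 2) (e4 m) ^ 2) * ‖(𝐰 (z i)) m‖ₑ ^ 2 := by
      rw [Lattice.eNormSq, ← e4.tsum_eq]
      refine tsum_congr fun m => ?_
      simp [hu]
    rw [h1]
    calc ∑' m : ℤ × (Fin 3 → ℤ), ENNReal.ofReal (sobolevWeight (1 / 2) (e4 m) ^ 2) * ‖(𝐰 (z i)) m‖ₑ ^ 2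
        ≤ ∑' m : ℤ × (Fin 3 → ℤ), 2 * (ENNReal.ofReal (Λ m) * ‖(𝐰 (z i)) m‖ₑ ^ 2) := by
          refine ENNReal.tsum_le_tsum fun m => ?_
          by_cases hm : m.2 = 0
          · rw [W_zero' hW (z i) hm]; simp
          · have h2 : sobolevWeight (1 / 2) (e4 m) ^ 2 ≤ 2 * Λ m := sobolevWeight_half_sq_cons_le hm
            calc ENNReal.ofReal (sobolevWeight (1 / 2) (e4 m) ^ 2) * ‖(𝐰 (z i)) m‖ₑ ^ 2
                ≤ ENNReal.ofReal (2 * Λ m) * ‖(𝐰 (z i)) m‖ₑ ^ 2 := mul_le_mul' (ENNReal.ofReal_le_ofReal h2) le_rfl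
              _ = 2 * (ENNReal.ofReal (Λ m) * ‖(𝐰 (z i)) m‖ₑ ^ 2) := by
                  rw [ENNReal.ofReal_mul (by norm_num : (0:ℝ) ≤ 2), ENNReal.ofReal_ofNat, mul_assoc]
      _ = 2 * ∑' m : ℤ × (Fin 3 → ℤ), ENNReal.ofReal (Λ m) * ‖(𝐰 (z i)) m‖ₑ ^ 2 := ENNReal.tsum_mul_left
      _ ≤ 2 * ρ := mul_le_mul' le_rfl (hz i)
  obtain ⟨φ, hφ, hC⟩ := Lattice.rellich (V := EuclideanSpace ℂ (Fin 3)) (s := (0 : ℝ)) (t := 1 / 2) (by norm_num)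
    (ENNReal.mul_ne_top (by norm_num) hρ) hbound
  -- the subsequence is Cauchy in `W`
  have hcau : CauchySeq (z ∘ φ) := by
    rw [Metric.cauchySeq_iff]
    intro ε hε
    obtain ⟨N, hN⟩ := hC (ENNReal.ofReal (ε / 2) ^ 2) (by positivity)
    refine ⟨N, fun i hi j hj => ?_⟩
    have h := hN i j hi hj
    have hdist : ‖(z ∘ φ) i - (z ∘ φ) j‖ₑ ^ 2 ≤ ENNReal.ofReal (ε / 2) ^ 2 := by
      refine le_trans (le_of_eq ?_) h
      rw [Function.comp_apply, Function.comp_apply, ← enorm_coeW_sub, l2_enorm_sq_eq_tsum, Lattice.eNormSq,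
        ← e4.tsum_eq]
      refine tsum_congr fun m => ?_
      rw [sobolevWeight_zero, one_pow, ENNReal.ofReal_one, one_mul, coeW_sub]
      simp [hu]
    have h2 : ‖(z ∘ φ) i - (z ∘ φ) j‖ₑ ≤ ENNReal.ofReal (ε / 2) :=
      (ENNReal.pow_le_pow_left_iff two_ne_zero).1 hdist
    rw [← ofReal_norm, ENNReal.ofReal_le_ofReal_iff (by positivity)] at h2
    rw [dist_eq_norm]
    linarith
  obtain ⟨x, hx⟩ := cauchySeq_tendsto_of_complete hcau
  exact ⟨x, hclosed.mem_of_tendsto hx (Eventually.of_forall fun i => hz (φ i)), φ, hφ, hx⟩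

end Embedding

/-! ## §D″ Compactness of the linearised convective operator -/

section Compact

variable {W : Submodule ℝ (lp (fun _ : ℤ × (Fin 3 → ℤ) => EuclideanSpace ℂ (Fin 3)) 2)}
variable (hW : ∀ x : lp (fun _ : ℤ × (Fin 3 → ℤ) => EuclideanSpace ℂ (Fin 3)) 2, x ∈ W ↔
      (∀ n : ℤ, (x : ℤ × (Fin 3 → ℤ) → EuclideanSpace ℂ (Fin 3)) (n, 0) = 0) ∧
      (∀ mm : ℤ × (Fin 3 → ℤ), (∑ jj : Fin 3, ((mm.2 jj : ℤ) : ℂ) *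
        ((x : ℤ × (Fin 3 → ℤ) → EuclideanSpace ℂ (Fin 3)) mm) jj) = 0) ∧
      (∀ mm : ℤ × (Fin 3 → ℤ), (x : ℤ × (Fin 3 → ℤ) → EuclideanSpace ℂ (Fin 3)) (-mm) =
        conjVec ((x : ℤ × (Fin 3 → ℤ) → EuclideanSpace ℂ (Fin 3)) mm)))

include hW in
/-- **The linearised convective operator is compact** (Kielhöfer 2012, Prop. I.8.1; Henry 1981,
§7.2 for the period-map version): if `x₀ ∈ W` has physical coefficients `x₀/Λ` summable against
`(1 + Λ)⟨k⟩` (true for the space–time Fourier coefficients of a smooth time-periodic field), then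
`K w = B(x₀, w) + B(w, x₀)` maps the unit ball of `W` into the compact set
`{∑ Λ |z|² ≤ R²}`, hence is a compact operator on `W`. [folklore] -/
theorem isCompactOperator_linearised (hWc : IsClosed (W : Set (lp (fun _ : ℤ × (Fin 3 → ℤ) => EuclideanSpace ℂ (Fin 3)) 2)))
    {B : W → W → W} (hB : ∀ (x y : W) (m : ℤ × (Fin 3 → ℤ)), (𝐰 (B x y)) m = Torus.lerayCoeff m.2 (𝐍[𝐜 (𝐰 x), 𝐜 (𝐰 y)] m))
    (x₀ : W) (hx₀ : ∑' m : ℤ × (Fin 3 → ℤ), ENNReal.ofReal ((1 + Λ m) * sobolevWeight 1 m.2) * ‖(𝐜 (𝐰 x₀)) m‖ₑ ≠ ∞)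
    (K : W →L[ℝ] W) (hK : ∀ w, K w = B x₀ w + B w x₀) : IsCompactOperator K := by
  set A : ℝ≥0∞ := ∑' m : ℤ × (Fin 3 → ℤ), ENNReal.ofReal ((1 + Λ m) * sobolevWeight 1 m.2) * ‖(𝐜 (𝐰 x₀)) m‖ₑ with hA
  set C : ℝ≥0∞ := (2 * ENNReal.ofReal (18 * Real.pi * (4 * Real.sqrt 2)) ^ 2 +
    2 * ENNReal.ofReal (18 * Real.pi * (2 * Real.sqrt 2)) ^ 2) * A ^ 2 with hCdef
  have hCtop : C ≠ ∞ := ENNReal.mul_ne_top (ENNReal.add_ne_top.2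
    ⟨ENNReal.mul_ne_top (by norm_num) (ENNReal.pow_ne_top ENNReal.ofReal_ne_top),
      ENNReal.mul_ne_top (by norm_num) (ENNReal.pow_ne_top ENNReal.ofReal_ne_top)⟩) (ENNReal.pow_ne_top hx₀)
  refine (isCompactOperator_iff_image_closedBall_subset_compact (K : W →ₗ[ℝ] W) zero_lt_one).2
    ⟨{z : W | ∑' m, ENNReal.ofReal (Λ m) * ‖(𝐰 z) m‖ₑ ^ 2 ≤ C}, isCompact_wt_le hW hWc hCtop, ?_⟩
  rintro _ ⟨w, hw, rfl⟩
  rw [Metric.mem_closedBall, dist_zero_right] at hw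
  change ∑' m, ENNReal.ofReal (Λ m) * ‖(𝐰 (K w)) m‖ₑ ^ 2 ≤ C
  have hcoe : ∀ m, (𝐰 (K w)) m = Torus.lerayCoeff m.2 (𝐍[𝐜 (𝐰 x₀), 𝐜 (𝐰 w)] m) +
      Torus.lerayCoeff m.2 (𝐍[𝐜 (𝐰 w), 𝐜 (𝐰 x₀)] m) := by
    intro m
    rw [hK, coeW_add, Pi.add_apply, hB, hB]
  rw [tsum_congr fun m => by rw [hcoe m]]
  refine (tsum_wt_mul_enorm_linearised_le (𝐰 x₀) (𝐰 w) (W_zero hW w)).trans ?_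
  rw [hCdef, ← hA, ← l2_enorm_sq_eq_tsum]
  have hw' : ‖(w : lp (fun _ : ℤ × (Fin 3 → ℤ) => EuclideanSpace ℂ (Fin 3)) 2)‖ₑ ≤ 1 := by
    rw [← ofReal_norm, ← ENNReal.ofReal_one]
    exact ENNReal.ofReal_le_ofReal hw
  calc (2 * ENNReal.ofReal (18 * Real.pi * (4 * Real.sqrt 2)) ^ 2 + 2 * ENNReal.ofReal (18 * Real.pi * (2 * Real.sqrt 2)) ^ 2) *
        (A ^ 2 * ‖(w : lp (fun _ : ℤ × (Fin 3 → ℤ) => EuclideanSpace ℂ (Fin 3)) 2)‖ₑ ^ 2)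
      ≤ (2 * ENNReal.ofReal (18 * Real.pi * (4 * Real.sqrt 2)) ^ 2 + 2 * ENNReal.ofReal (18 * Real.pi * (2 * Real.sqrt 2)) ^ 2) *
        (A ^ 2 * 1 ^ 2) := by gcongr
    _ = _ := by ring

end Compact

end TimePeriodicLattice

end Literature.Analysis.FluidPDE
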